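import Literature.NumberTheory.LFunctions.RayClassLFunctionLocal
import Literature.NumberTheory.LFunctions.ClassGroupLogFreeLemmaB
import Literature.NumberTheory.LFunctions.LogFreeLemmaBAbstractLargeSlack
import HarnessLib

/-!
# Bombieri's Lemme B for the Hecke `L`-functions of ray class characters — every degree

Topic `Literature/NumberTheory/LFunctions`, namespace `Literature.NumberTheory.LFunctions`.
Everything here is PROVED (one definition with body, theorems; no named facts).

The ray-class analogue of the tree's `ClassGroupLogFreeLemmaB(AllDegrees).lean` (conductor `1`).  For a ray class
character `ψ mod 𝔪 ≠ 0` of the number field `K` (`n_K ≤ n`), non-principal on the primes `∤ 𝔪`, with primitive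
data `D` (`χ₀ mod 𝔣`, entire `L`; `RayClassLFunctionLocal.lean`) and `w = 1 + iv`:
`−L'/L(s) = Σ_m Λ_{χ₀}(m) m^{−s}` (`Λ_{χ₀} = twistVonMangoldt K (rayClassCoeffHom 𝔣 χ₀)`, `|Λ_{χ₀}(m)| ≤ n_K Λ(m)`),
so with the normalised coefficients `b_m = Λ_{χ₀}(m) m^{−1−iv}/n_K` (`rayCoefB`, `|b_m| ≤ Λ(m)/m`) Lemme A for `L`
(`lemmeA_rayClass`) gives the hypothesis of the abstract large-slack Lemme B
(`LogFreeDensity.lemmeB_core_abstract_of_le`, slack `η = n_K ≤ n ≤ K`):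
* `lemmeB_rayClass_of_le (n)` — **Lemme B for `L(s, χ₀)`**: there are `A₀, r₀ > 0` depending only on `n` such
  that for `n_K ≤ n`, `ℒ'_v ≤ L'` (`ℒ' = rayLemmaAHeight K 𝔪 v`), `0 < r ≤ r₀`, `rL' ≥ 1`, a zero of `L` within `r`
  of `1 + iv`, `log x ≥ A₀ L'`, `z ≤ x^{a₀/2}`:
  `e^{−10}/n² · x^{−r/10}/r³ ≤ ∫_{⌊x^{a₀}⌋}^{x} ‖Σ_{⌊x^{a₀}⌋ < m ≤ t, m = p^j, p > z} b_m‖² dt/t`.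

## References
* [Bombieri1987GrandCrible] E. Bombieri, Astérisque 18 (1987), §6 Lemme B, pp. 46–48.
* [ThornerZaman2017] J. Thorner, A. Zaman, Algebra Number Theory 11 (2017), §5.
* [Weiss1983] A. Weiss, J. reine angew. Math. 338 (1983) 56–94, §4.
-/

noncomputable section

open Complex Metric Set Filter Finset NumberField IsDedekindDomain
open scoped Real Topology LSeries.notation ArithmeticFunction.vonMangoldt NumberField

namespace Literature.NumberTheory.LFunctions

open Literature.NumberTheory.LFunctions.LogFreeLocal Literature.NumberTheory.LFunctions.LogFreeDensity
  Literature.NumberTheory.LFunctions.NumberField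
open scoped nonZeroDivisors

variable {K : Type*} [Field K] [NumberField K] {𝔪 : Ideal (𝓞 K)} {ψ : HeightOneSpectrum (𝓞 K) → ℂ}

namespace RayClassPrimitiveData

variable (D : RayClassPrimitiveData 𝔪 ψ)

/-! ### The coefficients `Λ_{χ₀}` and `b_m` -/

/-- `‖χ₀(𝔞)‖ ≤ 1` for the coefficient homomorphism of the primitive associate. [cite: Bombieri1987GrandCrible, §6 Lemme B] -/
theorem norm_coeffHom_le : ∀ I, ‖rayClassCoeffHom D.𝔣 D.χ₀ I‖ ≤ 1 :=
  norm_rayClassCoeffHom_le D.ne_bot D.norm_le_one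

/-- `|Λ_{χ₀}(m)| ≤ n_K Λ(m)`. [cite: Bombieri1987GrandCrible, §6 Lemme B] -/
theorem norm_twistVonMangoldt_le (m : ℕ) :
    ‖twistVonMangoldt K (rayClassCoeffHom D.𝔣 D.χ₀) m‖ ≤ Module.finrank ℚ K * Λ m :=
  (NumberField.norm_twistVonMangoldt_le D.norm_coeffHom_le m).trans (vonMangoldtNorm_le_finrank_mul m)

/-- `Λ_{χ₀}(m) = 0` off the prime powers. [cite: Bombieri1987GrandCrible, §6 Lemme B] -/
theorem twistVonMangoldt_eq_zero {m : ℕ} (hm : ¬ IsPrimePow m) :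
    twistVonMangoldt K (rayClassCoeffHom D.𝔣 D.χ₀) m = 0 := by
  have h := NumberField.norm_twistVonMangoldt_le D.norm_coeffHom_le m
  rw [vonMangoldtNorm_eq_zero_of_not_isPrimePow hm] at h
  exact norm_le_zero_iff.mp h

/-- The normalised coefficients `b_m = Λ_{χ₀}(m) m^{−1−iv}/n_K`. [cite: Bombieri1987GrandCrible, §6 Lemme B] -/
def coefB (v : ℝ) (m : ℕ) : ℂ :=
  twistVonMangoldt K (rayClassCoeffHom D.𝔣 D.χ₀) m * (m : ℂ) ^ (-(1 + (v : ℂ) * I)) / (Module.finrank ℚ K : ℂ)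

/-- `‖b_m‖ ≤ Λ(m)/m`. [cite: Bombieri1987GrandCrible, §6 Lemme B] -/
theorem norm_coefB_le (v : ℝ) (m : ℕ) : ‖D.coefB v m‖ ≤ Λ m / m := by
  have hnK : (0 : ℝ) < Module.finrank ℚ K := by exact_mod_cast Module.finrank_pos (R := ℚ) (M := K)
  rcases Nat.eq_zero_or_pos m with rfl | hm
  · simp [coefB, twistVonMangoldt_zero]
  rw [coefB, norm_div, norm_mul, Complex.norm_natCast]
  have hcpow : ‖(m : ℂ) ^ (-(1 + (v : ℂ) * I))‖ = (m : ℝ)⁻¹ := by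
    rw [Complex.norm_natCast_cpow_of_pos hm]; simp [Real.rpow_neg_one]
  rw [hcpow, div_le_div_iff₀ hnK (by exact_mod_cast hm)]
  have h := D.norm_twistVonMangoldt_le m
  calc ‖twistVonMangoldt K (rayClassCoeffHom D.𝔣 D.χ₀) m‖ * (m : ℝ)⁻¹ * m
      = ‖twistVonMangoldt K (rayClassCoeffHom D.𝔣 D.χ₀) m‖ := by field_simp
    _ ≤ Module.finrank ℚ K * Λ m := h
    _ = Λ m * Module.finrank ℚ K := mul_comm _ _

/-- `b_m = 0` off the prime powers. [cite: Bombieri1987GrandCrible, §6 Lemme B] -/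
theorem coefB_eq_zero_of_not_isPrimePow (v : ℝ) {m : ℕ} (hm : ¬ IsPrimePow m) : D.coefB v m = 0 := by
  simp [coefB, D.twistVonMangoldt_eq_zero hm]

/-! ### `(L'/L)^{(k)}` as a Dirichlet series -/

/-- For `Re s > 1`: `L'/L` agrees near `s` with `−L(Λ_{χ₀}, ·)`. [cite: Bombieri1987GrandCrible, §6 Lemme B] -/
theorem logDeriv_eventuallyEq {s : ℂ} (hs : 1 < s.re) :
    logDeriv D.L =ᶠ[𝓝 s] fun z => -LSeries (twistVonMangoldt K (rayClassCoeffHom D.𝔣 D.χ₀)) z := by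
  have hopen : IsOpen {z : ℂ | 1 < z.re} := isOpen_lt continuous_const Complex.continuous_re
  filter_upwards [hopen.mem_nhds hs] with z hz
  rw [logDeriv_apply, ← neg_logDeriv_continuation_eq_LSeries D.ne_bot D.norm_le_one D.L_eq hz, neg_neg]

/-- The abscissa of absolute convergence of `Λ_{χ₀}` is `≤ 1`. [cite: Bombieri1987GrandCrible, §6 Lemme B] -/
theorem abscissaOfAbsConv_twistVonMangoldt_le :
    LSeries.abscissaOfAbsConv (twistVonMangoldt K (rayClassCoeffHom D.𝔣 D.χ₀)) ≤ 1 :=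
  LSeries.abscissaOfAbsConv_le_of_forall_lt_LSeriesSummable fun y hy =>
    LSeriesSummable_twistVonMangoldt D.norm_coeffHom_le (by simpa using hy)

/-- **`(L'/L)^{(k)}(s) = (−1)^{k+1} L(log^k · Λ_{χ₀}, s)`** for `Re s > 1`. [cite: Bombieri1987GrandCrible, §6 Lemme B] -/
theorem iteratedDeriv_logDeriv_eq {s : ℂ} (hs : 1 < s.re) (k : ℕ) :
    iteratedDeriv k (logDeriv D.L) s =
      (-1) ^ (k + 1) * LSeries (LSeries.logMul^[k] (twistVonMangoldt K (rayClassCoeffHom D.𝔣 D.χ₀))) s := by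
  rw [(D.logDeriv_eventuallyEq hs).iteratedDeriv_eq, iteratedDeriv_fun_neg,
    LSeries_iteratedDeriv k (lt_of_le_of_lt D.abscissaOfAbsConv_twistVonMangoldt_le (by exact_mod_cast hs))]
  ring

/-- **The terms in terms of `p_k`**: for `s₀ = 1 + r + iv`, `r > 0`,
`(log m)^k Λ_{χ₀}(m) m^{−s₀} = k! r^{−k} n_K · b_m p_k(r log m)`. [cite: Bombieri1987GrandCrible, §6 Lemme B] -/
theorem term_logMul_eq_coefB (v : ℝ) {r : ℝ} (hr : 0 < r) (k m : ℕ) :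
    LSeries.term (LSeries.logMul^[k] (twistVonMangoldt K (rayClassCoeffHom D.𝔣 D.χ₀))) (((1 + r : ℝ) : ℂ) + (v : ℂ) * I) m =
      (k.factorial : ℂ) * (r⁻¹ : ℂ) ^ k * (Module.finrank ℚ K : ℂ) * gTermB (D.coefB v) r k m := by
  rcases Nat.eq_zero_or_pos m with rfl | hm
  · rw [LSeries.term_zero, gTermB, coefB]
    simp [twistVonMangoldt_zero]
  have hm0 : (0 : ℝ) < m := by exact_mod_cast hm
  have hmC : (m : ℂ) ≠ 0 := by exact_mod_cast hm.ne'
  have hnK : (Module.finrank ℚ K : ℂ) ≠ 0 := by exact_mod_cast (Module.finrank_pos (R := ℚ) (M := K)).ne'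
  have hfun : LSeries.logMul^[k] (twistVonMangoldt K (rayClassCoeffHom D.𝔣 D.χ₀)) =
      fun m : ℕ ↦ (Real.log m : ℂ) ^ k * twistVonMangoldt K (rayClassCoeffHom D.𝔣 D.χ₀) m :=
    funext fun m ↦ logMul_iterate_apply _ k m
  rw [hfun, LSeries.term_of_ne_zero hm.ne', gTermB, coefB]
  set a : ℂ := twistVonMangoldt K (rayClassCoeffHom D.𝔣 D.χ₀) m with ha
  have hcancel : (k.factorial : ℂ) * (r⁻¹ : ℂ) ^ k * (Module.finrank ℚ K : ℂ) *
      (a * (m : ℂ) ^ (-(1 + (v : ℂ) * I)) / (Module.finrank ℚ K : ℂ) * (pk k (r * Real.log m) : ℂ)) =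
      (k.factorial : ℂ) * (r⁻¹ : ℂ) ^ k * (a * (m : ℂ) ^ (-(1 + (v : ℂ) * I))) * (pk k (r * Real.log m) : ℂ) := by
    field_simp
  rw [hcancel]
  have hsplit : (m : ℂ) ^ (((1 + r : ℝ) : ℂ) + (v : ℂ) * I) =
      (m : ℂ) ^ ((1 : ℂ) + (v : ℂ) * I) * (((m : ℝ) ^ r : ℝ) : ℂ) := by
    rw [show (((1 + r : ℝ) : ℂ) + (v : ℂ) * I) = ((1 : ℂ) + (v : ℂ) * I) + (r : ℂ) by push_cast; ring,
      Complex.cpow_add _ _ hmC, Complex.ofReal_cpow hm0.le]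
    norm_cast
  have hreal := pow_log_mul_rpow_neg_eq hr k hm0
  have hfac : (k.factorial : ℝ) ≠ 0 := by positivity
  have hreal' : Real.log m ^ k * (m : ℝ) ^ (-r) = (k.factorial : ℝ) * (r⁻¹ ^ k * pk k (r * Real.log m)) := by
    rw [← hreal]; field_simp
  have hrpow : ((m : ℝ) ^ r : ℝ) ≠ 0 := (Real.rpow_pos_of_pos hm0 r).ne'
  have hneg : (((m : ℝ) ^ (-r) : ℝ) : ℂ) = ((((m : ℝ) ^ r : ℝ) : ℂ))⁻¹ := by
    rw [Real.rpow_neg hm0.le]; push_cast; rfl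
  have hcpow1 : (m : ℂ) ^ ((1 : ℂ) + (v : ℂ) * I) ≠ 0 := by
    rw [Ne, Complex.cpow_eq_zero_iff]; exact fun h => hmC h.1
  rw [hsplit, show (-(1 + (v : ℂ) * I)) = -((1 : ℂ) + (v : ℂ) * I) by ring, Complex.cpow_neg]
  have hcast := congr_arg (fun x : ℝ => (x : ℂ)) hreal'
  simp only [Complex.ofReal_mul, Complex.ofReal_pow, Complex.ofReal_natCast, Complex.ofReal_inv] at hcast
  rw [hneg] at hcast
  field_simp
  linear_combination a * hcast

/-- The weighted series is summable (`r > 0`). [cite: Bombieri1987GrandCrible, §6 Lemme B] -/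
theorem summable_gTermB_coefB (v : ℝ) {r : ℝ} (hr : 0 < r) (k : ℕ) : Summable (gTermB (D.coefB v) r k) := by
  have habs : LSeries.abscissaOfAbsConv (LSeries.logMul^[k] (twistVonMangoldt K (rayClassCoeffHom D.𝔣 D.χ₀))) ≤ 1 := by
    induction k with
    | zero => exact D.abscissaOfAbsConv_twistVonMangoldt_le
    | succ k ih => rw [Function.iterate_succ', Function.comp, LSeries.abscissaOfAbsConv_logMul]; exact ih
  have hsum : LSeriesSummable (LSeries.logMul^[k] (twistVonMangoldt K (rayClassCoeffHom D.𝔣 D.χ₀)))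
      (((1 + r : ℝ) : ℂ) + (v : ℂ) * I) := by
    refine LSeriesSummable_of_abscissaOfAbsConv_lt_re (lt_of_le_of_lt habs ?_)
    have : (((1 + r : ℝ) : ℂ) + (v : ℂ) * I).re = 1 + r := by simp
    rw [this]; exact_mod_cast (show (1:ℝ) < 1 + r by linarith)
  have hnK : (Module.finrank ℚ K : ℂ) ≠ 0 := by exact_mod_cast (Module.finrank_pos (R := ℚ) (M := K)).ne'
  have h := hsum.mul_left ((r : ℂ) ^ k / (k.factorial * (Module.finrank ℚ K : ℂ)))
  refine h.congr fun m => ?_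
  rw [D.term_logMul_eq_coefB v hr k m, inv_pow]
  have hfac : (k.factorial : ℂ) ≠ 0 := by exact_mod_cast k.factorial_ne_zero
  have hrC : (r : ℂ) ^ k ≠ 0 := pow_ne_zero _ (by exact_mod_cast hr.ne')
  field_simp

/-- **The norm of `(L'/L)^{(k)}(s₀)`**: `= k! r^{−k} n_K ‖Σ_m b_m p_k(r log m)‖`.
[cite: Bombieri1987GrandCrible, §6 Lemme B] -/
theorem norm_iteratedDeriv_logDeriv_eq (v : ℝ) {r : ℝ} (hr : 0 < r) (k : ℕ) :
    ‖iteratedDeriv k (logDeriv D.L) (((1 + r : ℝ) : ℂ) + (v : ℂ) * I)‖ =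
      k.factorial * r⁻¹ ^ k * Module.finrank ℚ K * ‖∑' m, gTermB (D.coefB v) r k m‖ := by
  have hs₀re : 1 < (((1 + r : ℝ) : ℂ) + (v : ℂ) * I).re := by simp; linarith
  rw [D.iteratedDeriv_logDeriv_eq hs₀re k, norm_mul, norm_pow, norm_neg, norm_one, one_pow, one_mul, LSeries]
  have htsum : ∑' m, LSeries.term (LSeries.logMul^[k] (twistVonMangoldt K (rayClassCoeffHom D.𝔣 D.χ₀)))
      (((1 + r : ℝ) : ℂ) + (v : ℂ) * I) m =
      (k.factorial : ℂ) * (r⁻¹ : ℂ) ^ k * (Module.finrank ℚ K : ℂ) * ∑' m, gTermB (D.coefB v) r k m := by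
    rw [← tsum_mul_left]
    exact tsum_congr fun m => D.term_logMul_eq_coefB v hr k m
  rw [htsum, norm_mul, norm_mul, norm_mul, Complex.norm_natCast, norm_pow, norm_inv, Complex.norm_real,
    Real.norm_eq_abs, abs_of_pos hr, Complex.norm_natCast]

end RayClassPrimitiveData

/-! ### Lemme A on the series side and Lemme B -/

/-- **Lemme A on the series side** for `L(s, χ₀)`: with the constant `c₄` of `lemmeA_rayClass`, for
`K' ≥ c₄ rℒ' + 2` there is `k ∈ [K', 2K']` with `e^{−10K'} 2^{−(k+1)}/r ≤ n_K ‖Σ_m b_m p_k(r log m)‖`.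
[cite: Bombieri1987GrandCrible, §6 Lemme B] -/
theorem exists_norm_tsum_gTermB_ge_rayClass :
    ∃ c₄ : ℝ, 0 < c₄ ∧ ∀ (K : Type*) [Field K] [NumberField K] (𝔪 : Ideal (𝓞 K))
      (ψ : HeightOneSpectrum (𝓞 K) → ℂ) (D : RayClassPrimitiveData 𝔪 ψ),
      (∃ v : HeightOneSpectrum (𝓞 K), ¬ 𝔪 ≤ v.asIdeal ∧ ψ v ≠ 1) →
      ∀ (v r L' : ℝ), rayLemmaAHeight K 𝔪 v ≤ L' → 0 < r → 512 * r ≤ 1 / 8 → 1 ≤ r * L' →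
        (∃ ρ₀ : ℂ, D.L ρ₀ = 0 ∧ ‖ρ₀ - (1 + (v : ℂ) * I)‖ ≤ r) →
        ∀ K' : ℕ, c₄ * (r * L') + 2 ≤ K' →
          ∃ k ∈ Finset.Icc K' (2 * K'),
            Real.exp (-(10 * K')) * (2⁻¹ ^ (k + 1) / r) ≤
              Module.finrank ℚ K * ‖∑' m, gTermB (D.coefB v) r k m‖ := by
  obtain ⟨c₄, h₄, hA⟩ := lemmeA_rayClass
  refine ⟨c₄, h₄, fun K _ _ 𝔪 ψ D hnt v r L' hL hr hr8 hu hzero K' hK' => ?_⟩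
  obtain ⟨k, hk, hbound⟩ := hA K 𝔪 ψ D hnt v r L' hL hr hr8 hu hzero K' hK'
  refine ⟨k, hk, ?_⟩
  rw [D.norm_iteratedDeriv_logDeriv_eq v hr k] at hbound
  have hfacpos : (0 : ℝ) < k.factorial := by positivity
  have hsimp : (k.factorial : ℝ) * r⁻¹ ^ k * Module.finrank ℚ K * ‖∑' m, gTermB (D.coefB v) r k m‖ / k.factorial =
      r⁻¹ ^ k * (Module.finrank ℚ K * ‖∑' m, gTermB (D.coefB v) r k m‖) := by field_simp
  rw [hsimp] at hbound
  have key : Real.exp (-(10 * K')) * (2⁻¹ ^ (k + 1) / r) =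
      r ^ k * (Real.exp (-(10 * K')) * (2 * r)⁻¹ ^ (k + 1)) := by
    rw [mul_inv, mul_pow, pow_succ r⁻¹ k, inv_pow, inv_pow]
    field_simp
  rw [key]
  calc r ^ k * (Real.exp (-(10 * K')) * (2 * r)⁻¹ ^ (k + 1))
      ≤ r ^ k * (r⁻¹ ^ k * (Module.finrank ℚ K * ‖∑' m, gTermB (D.coefB v) r k m‖)) :=
        mul_le_mul_of_nonneg_left hbound (by positivity)
    _ = Module.finrank ℚ K * ‖∑' m, gTermB (D.coefB v) r k m‖ := by
        rw [← mul_assoc, ← mul_pow, mul_inv_cancel₀ hr.ne', one_pow, one_mul]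

/-- **Bombieri's Lemme B for the Hecke `L`-function of a ray class character, every degree** (uniformly over
the number fields of degree `≤ n`, the moduli and the characters): there are `A₀, r₀ > 0` depending only on
`n` such that for `n_K ≤ n`, `𝔪 ≠ 0`, `ψ mod 𝔪` non-principal on the primes `∤ 𝔪` with primitive data `D`,
`ℒ'_v ≤ L'` (`ℒ' = rayLemmaAHeight K 𝔪 v`), `0 < r ≤ r₀`, `rL' ≥ 1`, a zero `ρ₀` of `L` with `|ρ₀ − (1+iv)| ≤ r`,
`0 < x`, `log x ≥ A₀ L'` and `z ≤ x^{a₀/2}`,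
`e^{−10}/n² · x^{−r/10}/r³ ≤ ∫_{⌊x^{a₀}⌋}^{x} ‖Σ_{⌊x^{a₀}⌋ < m ≤ t, m = p^j, p > z} b_m‖² dt/t`.
[cite: Bombieri1987GrandCrible, §6 Lemme B] -/
theorem lemmeB_rayClass_of_le (n : ℕ) :
    ∃ A₀ r₀ : ℝ, 0 < A₀ ∧ 0 < r₀ ∧
      ∀ (K : Type*) [Field K] [NumberField K] (𝔪 : Ideal (𝓞 K)) (ψ : HeightOneSpectrum (𝓞 K) → ℂ)
      (D : RayClassPrimitiveData 𝔪 ψ), (∃ v : HeightOneSpectrum (𝓞 K), ¬ 𝔪 ≤ v.asIdeal ∧ ψ v ≠ 1) →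
      Module.finrank ℚ K ≤ n →
      ∀ (v r L' x : ℝ) (z : ℕ), rayLemmaAHeight K 𝔪 v ≤ L' → 0 < r → r ≤ r₀ → 1 ≤ r * L' →
        (∃ ρ₀ : ℂ, D.L ρ₀ = 0 ∧ ‖ρ₀ - (1 + (v : ℂ) * I)‖ ≤ r) →
        0 < x → A₀ * L' ≤ Real.log x → (z : ℝ) ≤ x ^ (expoB / 2) →
          Real.exp (-10) / (n : ℝ) ^ 2 * x ^ (-(r / 10)) / r ^ 3 ≤
            ∫ t in Set.Ioc (⌊x ^ expoB⌋₊ : ℝ) x, ‖summatory (coefSiftedB (D.coefB v) x z) t‖ ^ 2 / t := by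
  obtain ⟨c₄, hc₄, hA⟩ := exists_norm_tsum_gTermB_ge_rayClass
  set θ : ℝ := Real.exp 14 with hθ
  have hθ1 : 1 ≤ θ := Real.one_le_exp (by norm_num)
  have hn0 : (0 : ℝ) ≤ n := Nat.cast_nonneg n
  refine ⟨240 * (c₄ + 8 * θ + 8 + n), 1 / (112 * θ), by positivity, by positivity,
    fun K _ _ 𝔪 ψ D hnt hnK v r L' x z hL hr hr0 hu hzero hx hlogx hz => ?_⟩
  have hL'1 : 1 ≤ L' := ((one_le_rayDiscBound D.modulus_ne_bot v).trans
    (rayDiscBound_le_rayLemmaAHeight D.modulus_ne_bot v)).trans hL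
  set u : ℝ := r * L' with hudef
  have hr1 : r ≤ 1 := by
    have : 1 / (112 * θ) ≤ 1 := by rw [div_le_one (by positivity)]; nlinarith
    linarith
  have hr8 : 512 * r ≤ 1 / 8 := by
    have h := hr0
    rw [le_div_iff₀ (by positivity)] at h
    have h14 : (4096 : ℝ) ≤ θ := by
      have := pow_le_exp_mul (c := 4096) (m := 14) (by norm_num) (by norm_num) 1
      simpa [hθ] using this
    nlinarith
  set Lx : ℝ := Real.log x with hLx
  have hA₀pos : 0 < 240 * (c₄ + 8 * θ + 8 + n) := by positivity
  have hLxpos : 0 < Lx := lt_of_lt_of_le (by positivity) hlogx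
  have hrLx : 240 * (c₄ + 8 * θ + 8 + n) * u ≤ r * Lx := by
    rw [hudef]
    have := mul_le_mul_of_nonneg_left hlogx hr.le
    linarith
  set K' : ℕ := ⌊r * Lx / 240⌋₊ with hKdef
  have hK1 : (K' : ℝ) ≤ r * Lx / 240 := Nat.floor_le (by positivity)
  have hKlow : (c₄ + 8 * θ + 8 + n) * u - 1 ≤ K' := by
    have hK2 : r * Lx / 240 < K' + 1 := Nat.lt_floor_add_one _
    have : (c₄ + 8 * θ + 8 + n) * u ≤ r * Lx / 240 := by
      rw [le_div_iff₀ (by norm_num)]; linarith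
    linarith
  have hu1 : (1 : ℝ) ≤ u := hu
  have hprod1 : 0 ≤ (8 * θ + 8 + n) * (u - 1) := mul_nonneg (by positivity) (by linarith only [hu1])
  have hprod2 : 0 ≤ c₄ * u := mul_nonneg hc₄.le (by linarith only [hu1])
  have hprod3 : 0 ≤ (n : ℝ) * u := mul_nonneg hn0 (by linarith only [hu1])
  have hKc : c₄ * (r * L') + 2 ≤ K' := by
    rw [← hudef]
    nlinarith only [hKlow, hprod1, hθ1, hu1, hn0]
  have hK8r : (8 : ℝ) ≤ K' := by
    nlinarith only [hKlow, hprod1, hprod2, hθ1, hu1, hn0]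
  have hK8 : 8 ≤ K' := by exact_mod_cast hK8r
  have hKθ : 8 * θ * u ≤ K' := by
    nlinarith only [hKlow, hprod2, hu1, hn0, hprod3]
  have hnK' : (n : ℝ) ≤ K' := by
    nlinarith only [hKlow, hprod1, hprod2, hθ1, hu1, hn0, hprod3]
  obtain ⟨k, hk, hmain⟩ := hA K 𝔪 ψ D hnt v r L' hL hr hr8 hu hzero K' hKc
  have hη1 : (1 : ℝ) ≤ Module.finrank ℚ K := by exact_mod_cast Module.finrank_pos (R := ℚ) (M := K)
  have hηn : (Module.finrank ℚ K : ℝ) ≤ n := by exact_mod_cast hnK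
  have hηK : (Module.finrank ℚ K : ℝ) ≤ K' := hηn.trans hnK'
  have h := lemmeB_core_abstract_of_le (D.norm_coefB_le v) (fun m hm ↦ D.coefB_eq_zero_of_not_isPrimePow v hm)
    hr hr0 hu hx hη1 hηK hK8 hKθ hk (D.summable_gTermB_coefB v hr k) hmain hz
  refine le_trans ?_ h
  have hsq : (Module.finrank ℚ K : ℝ) ^ 2 ≤ (n : ℝ) ^ 2 := pow_le_pow_left₀ (by positivity) hηn 2
  have hsqpos : 0 < (Module.finrank ℚ K : ℝ) ^ 2 := by positivity
  have hxr : 0 ≤ x ^ (-(r / 10)) / r ^ 3 := by positivity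
  have h1 : Real.exp (-10) / (n : ℝ) ^ 2 ≤ Real.exp (-10) / (Module.finrank ℚ K : ℝ) ^ 2 :=
    div_le_div_of_nonneg_left (Real.exp_pos _).le hsqpos hsq
  calc Real.exp (-10) / (n : ℝ) ^ 2 * x ^ (-(r / 10)) / r ^ 3
      = Real.exp (-10) / (n : ℝ) ^ 2 * (x ^ (-(r / 10)) / r ^ 3) := by ring
    _ ≤ Real.exp (-10) / (Module.finrank ℚ K : ℝ) ^ 2 * (x ^ (-(r / 10)) / r ^ 3) :=
        mul_le_mul_of_nonneg_right h1 hxr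
    _ = _ := by ring

end Literature.NumberTheory.LFunctions

end
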